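import Summits.CriticalPhenomena.PercolationContinuityZ3.Theorems.PercNearOneGluingNoHeavyLowerTailKnQuestion8CoefficientwiseQmixRootEdgeClasses
import HarnessLib

/-!
# The two-point exclusion at a point with a ROOT EDGE — the wall sum of `1_w` at a SMALL wall vertex (neighbours `q` and `w` only) is nonnegative — prim-lf-2 gen 51 (part 2b)

Support file (`--supports stmt-CriticalPhenomena-4575`, closed), prover `prim-lf-2` (gen 51).  No definitions, no named facts, no sorries; standard axioms.
Memo `prim-lf-2/CW-ROOTEDGE-gen51.md` §3; part 1 is `…CoefficientwiseQmixRootEdgeClasses.lean`.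

Setting as in part 1: finite multigraph `ends : ι → Sym2 V`, root `x`, `K(s) = openCluster (ends '' s) x`; `D` = ALL edges at the point `u`, a class `R ⊆ D` whose red edges go to `x`
(`eₓ`) and `q` (`e_q`) and whose blue edges `D ∖ R` go to `p`; on the sub-cube `r : Finset {j // j ∉ D}`: `a(r) = K(r⁺ ∪ R)`, `b(r) = K((rᶜ)⁺ ∪ (D ∖ R))`, and the ROOT-DOM wall sum of
the point function `1_w` at the wall vertex `p`:  `WC_R(p)[1_w] = Σ_r [p ∉ a r][p ∉ b r]·([w ∈ a r] − [w ∈ b r])`.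
* `wallClass_pointIndicator_nonneg_of_smallWall` — **if the only edges at `p` off `D` are `e₁ = pq` and `e₂ = pw`, then `WC_R(p)[1_w] ≥ 0`** on every finite multigraph.
  Proof: resolve `{e₁, e₂}` (`sum_cube_eq_sum_powerset_subcube` on the sub-cube); with `e₁` red `p ∈ a` (via `q`), so those two classes vanish; with `e₁` blue / `e₂` red, `p` is a red leaf at
  `w` and a blue leaf at `q` (pendant-edge lemma), the class summand is `−[w ∉ Ka][q ∉ Kb][w ∈ Kb]`; with both blue it is `[q ∉ Kb][w ∉ Kb][w ∈ Ka]` (`Ka`, `Kb` = the red / blue clusters of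
  `x` ignoring `e₁, e₂`); the two add up to `[q ∉ Kb]·([w ∈ Ka] − [w ∈ Kb])`, whose sum is `≥ 0` by 'Harris twice' (`AntitheticProduct.sum_mul_sub_compl_nonneg` + `Kb ⊆ Ka`-type termwise step).
This is the last ingredient for the 6-vertex residue of CONJECTURE NO-CORE for the points in the shape `N(u) = {p,q,x}` (part 3's `qmix_rootEdge_pointIndicator_nonneg_of_smallWalls`): there
`G − y − u` has vertex set `{x, w, p, q}`, so every wall vertex is small or adjacent to the root.  Exact check of the underlying identity
`WC(p)[1_w] = Σ_{t′ ⊆ E(G°−p) : q ∉ B′_x} ([w ∈ R′_{xq}] − [w ∈ B′_x])` on 400 random graphs (prim-lf-2 code/gen51/py/smallwall_check.py): 0 mismatches.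
[cite: KozmaNitzan2024, Questions 8–9 (§5.5 p. 36) (context: the Question-8 pocket covariance programme)]
-/

namespace Summit.CriticalPhenomena.PercolationContinuityZ3.Theorems

open Finset Literature.Probability.Percolation

namespace Coefficientwise

variable {ι V : Type*} [Fintype ι] [DecidableEq ι] (ends : ι → Sym2 V) (x : V)

section smallWall

variable {u p q w : V} (D R : Finset ι)

open Classical in
/-- **The ROOT-DOM wall sum of `1_w` at a small wall vertex is nonnegative.**  Let `D` be ALL edges at `u`, `R ⊆ D` with `eₓ ∈ R` (`{u,x}`), `e_q ∈ R` (`{u,q}`), every edge of `R` with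
ends `{u,x}` or `{u,q}`, every edge of `D ∖ R` with ends `{u,p}`; let `e₁ ≠ e₂` be edges with ends `{p,q}` and `{p,w}` and suppose every edge off `D` containing `p` is `e₁` or `e₂`
(`x, p, q, w ≠ u`; `x, q, w ≠ p`).  Then `0 ≤ Σ_r [p ∉ a r][p ∉ b r]·([w ∈ a r] − [w ∈ b r])`.  [cite: KozmaNitzan2024, Questions 8–9 (§5.5 p. 36) (context)] -/
theorem wallClass_pointIndicator_nonneg_of_smallWall (hdeg : ∀ i, u ∈ ends i → i ∈ D) (hD : ∀ i ∈ D, u ∈ ends i)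
    {eₓ : ι} (heₓ : ends eₓ = s(u, x)) (heₓR : eₓ ∈ R) (hxu : x ≠ u)
    {e_q : ι} (he_q : ends e_q = s(u, q)) (he_qR : e_q ∈ R) (hqu : q ≠ u)
    (hRends : ∀ i ∈ R, ends i = s(u, x) ∨ ends i = s(u, q))
    (hP : ∀ i ∈ D \ R, ends i = s(u, p)) (hpu : p ≠ u)
    {e₁ e₂ : ι} (he₁ : ends e₁ = s(p, q)) (he₂ : ends e₂ = s(p, w)) (hne : e₁ ≠ e₂)
    (hsmall : ∀ i, i ∉ D → p ∈ ends i → i = e₁ ∨ i = e₂)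
    (hwu : w ≠ u) (hxp : x ≠ p) (hqp : q ≠ p) (hwp : w ≠ p) :
    0 ≤ ∑ r : Finset {j : ι // j ∉ D},
      (if (p ∉ openCluster (ends '' (↑(r.map (Function.Embedding.subtype _) ∪ R) : Set ι)) x ∧
            p ∉ openCluster (ends '' (↑(rᶜ.map (Function.Embedding.subtype _) ∪ (D \ R)) : Set ι)) x) then
        ((if w ∈ openCluster (ends '' (↑(r.map (Function.Embedding.subtype _) ∪ R) : Set ι)) x then (1 : ℝ) else 0) -
          (if w ∈ openCluster (ends '' (↑(rᶜ.map (Function.Embedding.subtype _) ∪ (D \ R)) : Set ι)) x then (1 : ℝ) else 0))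
      else 0) := by
  set emb := Function.Embedding.subtype (fun j : ι => j ∉ D) with hemb
  set K : Finset ι → Set V := fun S => openCluster (ends '' (↑S : Set ι)) x with hK
  -- the two edges at `p` live in the sub-cube
  have he₁D : e₁ ∉ D := by
    intro h; have := hD e₁ h; rw [he₁, Sym2.mem_iff] at this
    rcases this with h1 | h1
    · exact hpu h1.symm
    · exact hqu h1.symm
  have he₂D : e₂ ∉ D := by
    intro h; have := hD e₂ h; rw [he₂, Sym2.mem_iff] at this
    rcases this with h1 | h1
    · exact hpu h1.symm
    · exact hwu h1.symm
  set e₁' : {j : ι // j ∉ D} := ⟨e₁, he₁D⟩ with he₁'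
  set e₂' : {j : ι // j ∉ D} := ⟨e₂, he₂D⟩ with he₂'
  have hne' : e₁' ≠ e₂' := fun h => hne (congrArg Subtype.val h)
  set D' : Finset {j : ι // j ∉ D} := {e₁', e₂'} with hD'
  set emb' := Function.Embedding.subtype (fun j' : {j : ι // j ∉ D} => j' ∉ D') with hemb'
  -- the wall summand as a function of (red part, blue part) of the sub-cube colouring
  set Φ : Finset {j : ι // j ∉ D} → Finset {j : ι // j ∉ D} → ℝ := fun s t =>
    if (p ∉ K (s.map emb ∪ R) ∧ p ∉ K (t.map emb ∪ (D \ R))) then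
      ((if w ∈ K (s.map emb ∪ R) then (1 : ℝ) else 0) - (if w ∈ K (t.map emb ∪ (D \ R)) then (1 : ℝ) else 0)) else 0 with hΦ
  change 0 ≤ ∑ r : Finset {j : ι // j ∉ D}, Φ r rᶜ
  rw [sum_cube_eq_sum_powerset_subcube D' Φ]
  -- reduced clusters (ignoring `e₁, e₂`)
  set Ta : Finset {j' : {j : ι // j ∉ D} // j' ∉ D'} → Finset ι := fun r' => (r'.map emb').map emb ∪ R with hTa
  set Tb : Finset {j' : {j : ι // j ∉ D} // j' ∉ D'} → Finset ι := fun r' => (r'ᶜ.map emb').map emb with hTb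
  -- membership bookkeeping
  have mem_mm : ∀ (t : Finset {j' : {j : ι // j ∉ D} // j' ∉ D'}) (i : ι),
      i ∈ (t.map emb').map emb ↔ ∃ h : i ∉ D, ∃ h' : (⟨i, h⟩ : {j : ι // j ∉ D}) ∉ D', (⟨⟨i, h⟩, h'⟩ : {j' : {j : ι // j ∉ D} // j' ∉ D'}) ∈ t := by
    intro t i
    rw [mem_map_subtype_iff]
    constructor
    · rintro ⟨h, hm⟩
      obtain ⟨h', hm'⟩ := (mem_map_subtype_iff (fun j' : {j : ι // j ∉ D} => j' ∉ D') t ⟨i, h⟩).mp hm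
      exact ⟨h, h', hm'⟩
    · rintro ⟨h, h', hm⟩
      exact ⟨h, (mem_map_subtype_iff (fun j' : {j : ι // j ∉ D} => j' ∉ D') t ⟨i, h⟩).mpr ⟨h', hm⟩⟩
  have notD'_iff : ∀ (i : ι) (h : i ∉ D), (⟨i, h⟩ : {j : ι // j ∉ D}) ∉ D' ↔ (i ≠ e₁ ∧ i ≠ e₂) := by
    intro i h
    rw [hD', Finset.mem_insert, Finset.mem_singleton, not_or]
    constructor
    · rintro ⟨h1, h2⟩
      exact ⟨fun hi => h1 (Subtype.ext hi), fun hi => h2 (Subtype.ext hi)⟩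
    · rintro ⟨h1, h2⟩
      exact ⟨fun hi => h1 (congrArg Subtype.val hi), fun hi => h2 (congrArg Subtype.val hi)⟩
  -- no edge of `Ta r'`, `Tb r'` contains `p`; no edge of `Tb r'` (or of `insert e₁ (Tb r')`, …) contains `u`
  have hR_p : ∀ i ∈ R, p ∉ ends i := by
    intro i hi hpi
    rcases hRends i hi with h | h <;> rw [h, Sym2.mem_iff] at hpi
    · rcases hpi with h1 | h1; exact hpu h1; exact hxp h1.symm
    · rcases hpi with h1 | h1; exact hpu h1; exact hqp h1.symm
  have hmm_p : ∀ (t : Finset {j' : {j : ι // j ∉ D} // j' ∉ D'}), ∀ i ∈ (t.map emb').map emb, p ∉ ends i := by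
    intro t i hi hpi
    obtain ⟨h, h', _⟩ := (mem_mm t i).mp hi
    obtain ⟨h1, h2⟩ := (notD'_iff i h).mp h'
    rcases hsmall i h hpi with h3 | h3
    · exact h1 h3
    · exact h2 h3
  have hmm_u : ∀ (t : Finset {j' : {j : ι // j ∉ D} // j' ∉ D'}), ∀ i ∈ (t.map emb').map emb, u ∉ ends i := by
    intro t i hi hui
    obtain ⟨h, _, _⟩ := (mem_mm t i).mp hi
    exact h (hdeg i hui)
  have hTa_p : ∀ r', ∀ i ∈ Ta r', p ∉ ends i := by
    intro r' i hi
    rcases Finset.mem_union.mp hi with hi | hi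
    · exact hmm_p r' i hi
    · exact hR_p i hi
  have hTb_p : ∀ r', ∀ i ∈ Tb r', p ∉ ends i := fun r' => hmm_p r'ᶜ
  have hTb_u : ∀ r', ∀ i ∈ Tb r', u ∉ ends i := fun r' => hmm_u r'ᶜ
  have he₁u : u ∉ ends e₁ := by rw [he₁, Sym2.mem_iff]; rintro (h | h); exact hpu h.symm; exact hqu h.symm
  have he₂u : u ∉ ends e₂ := by rw [he₂, Sym2.mem_iff]; rintro (h | h); exact hpu h.symm; exact hwu h.symm
  -- (1) in the red cluster, `q` and hence (if `e₁` is red) `p` are always reached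
  have hq_red : ∀ S : Finset ι, R ⊆ S → q ∈ K S := by
    intro S hRS
    have hu : u ∈ K S := (mem_openCluster_iff_of_edge ends x S heₓ hxu (hRS heₓR)).mpr (mem_openCluster_self _ x)
    exact (mem_openCluster_iff_of_edge ends x S he_q hqu (hRS he_qR)).mp hu
  have hp_red : ∀ S : Finset ι, R ⊆ S → e₁ ∈ S → p ∈ K S := by
    intro S hRS he₁S
    exact (mem_openCluster_iff_of_edge ends x S he₁ hqp he₁S).mpr (hq_red S hRS)
  -- (2) stripping the pendant star `D ∖ R` at `u` (far end `p`) does not change membership of vertices `≠ u`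
  have strip_u : ∀ (T : Finset ι), (∀ i ∈ T, u ∉ ends i) → ∀ v, v ≠ u → (v ∈ K (T ∪ (D \ R)) ↔ v ∈ K T) := by
    intro T hT v hvu
    constructor
    · intro hv
      rcases openCluster_union_pendantStar_subset ends x T (D \ R) hT hP hxu v hv with h | h
      · exact absurd h hvu
      · exact h
    · intro hv; exact openCluster_image_mono ends Finset.subset_union_left x hv
  -- abbreviations for the reduced clusters
  set Ka : Finset {j' : {j : ι // j ∉ D} // j' ∉ D'} → Set V := fun r' => K (Ta r') with hKa
  set Kb : Finset {j' : {j : ι // j ∉ D} // j' ∉ D'} → Set V := fun r' => K (Tb r') with hKb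
  -- (3) the four classes
  have hRsub : ∀ (X : Finset {j : ι // j ∉ D}), R ⊆ X.map emb ∪ R := fun X => Finset.subset_union_right
  -- classes containing `e₁'`: every summand vanishes
  have class_e₁ : ∀ R' ∈ D'.powerset, e₁' ∈ R' →
      ∑ r' : Finset {j' : {j : ι // j ∉ D} // j' ∉ D'}, Φ (r'.map emb' ∪ R') (r'ᶜ.map emb' ∪ (D' \ R')) = 0 := by
    intro R' _ he
    refine Finset.sum_eq_zero fun r' _ => ?_
    have hmem : e₁ ∈ (r'.map emb' ∪ R').map emb ∪ R :=
      Finset.mem_union_left _ (Finset.mem_map.mpr ⟨e₁', Finset.mem_union_right _ he, rfl⟩)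
    have hp : p ∈ K ((r'.map emb' ∪ R').map emb ∪ R) := hp_red _ (hRsub _) hmem
    simp only [hΦ]
    rw [if_neg (fun h => h.1 hp)]
  -- red and blue edge sets of the two remaining classes
  have hred₂ : ∀ r' : Finset {j' : {j : ι // j ∉ D} // j' ∉ D'}, (r'.map emb' ∪ {e₂'}).map emb ∪ R = insert e₂ (Ta r') := by
    intro r'
    rw [Finset.map_union, Finset.map_singleton, hTa]
    ext a
    simp only [Finset.mem_union, Finset.mem_singleton, Finset.mem_insert, hemb, Function.Embedding.coe_subtype]
    tauto
  have hblue₂ : ∀ r' : Finset {j' : {j : ι // j ∉ D} // j' ∉ D'}, (r'ᶜ.map emb' ∪ (D' \ {e₂'})).map emb ∪ (D \ R) = insert e₁ (Tb r') ∪ (D \ R) := by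
    intro r'
    have hD'e : D' \ {e₂'} = {e₁'} := by
      ext a
      rw [Finset.mem_sdiff, hD', Finset.mem_insert, Finset.mem_singleton, Finset.mem_singleton]
      constructor
      · rintro ⟨h1 | h1, h2⟩; exact h1; exact absurd h1 h2
      · intro h; exact ⟨Or.inl h, fun h2 => hne' (h ▸ h2)⟩
    rw [hD'e, Finset.map_union, Finset.map_singleton, hTb]
    ext a
    simp only [Finset.mem_union, Finset.mem_singleton, Finset.mem_insert, hemb, Function.Embedding.coe_subtype]
    tauto
  have hred₀ : ∀ r' : Finset {j' : {j : ι // j ∉ D} // j' ∉ D'}, (r'.map emb' ∪ ∅).map emb ∪ R = Ta r' := by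
    intro r'; rw [Finset.union_empty]
  have hD'map : D'.map emb = {e₁, e₂} := by
    rw [hD', Finset.map_insert, Finset.map_singleton]
    rfl
  have hblue₀ : ∀ r' : Finset {j' : {j : ι // j ∉ D} // j' ∉ D'}, (r'ᶜ.map emb' ∪ (D' \ ∅)).map emb ∪ (D \ R) = (Tb r' ∪ {e₁, e₂}) ∪ (D \ R) := by
    intro r'
    rw [Finset.sdiff_empty, Finset.map_union, hD'map]
  -- the class {e₂'}: p is a red leaf at w and a blue leaf at q
  have class_e₂ : ∀ r' : Finset {j' : {j : ι // j ∉ D} // j' ∉ D'},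
      Φ (r'.map emb' ∪ {e₂'}) (r'ᶜ.map emb' ∪ (D' \ {e₂'})) =
        (if (w ∉ Ka r' ∧ q ∉ Kb r') then (0 - (if w ∈ Kb r' then (1 : ℝ) else 0)) else 0) := by
    intro r'
    simp only [hΦ]
    rw [hred₂ r', hblue₂ r']
    obtain ⟨hA1, hA2, _⟩ := openCluster_insert_leafEdge ends x (Ta r') he₂ hwp hxp (hTa_p r')
    have hT1u : ∀ i ∈ insert e₁ (Tb r'), u ∉ ends i := by
      intro i hi; rcases Finset.mem_insert.mp hi with rfl | hi; exact he₁u; exact hTb_u r' i hi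
    obtain ⟨hB1, hB2, _⟩ := openCluster_insert_leafEdge ends x (Tb r') he₁ hqp hxp (hTb_p r')
    have hpB : p ∈ K (insert e₁ (Tb r') ∪ (D \ R)) ↔ q ∈ Kb r' := (strip_u _ hT1u p hpu).trans hB2
    have hwB : w ∈ K (insert e₁ (Tb r') ∪ (D \ R)) ↔ w ∈ Kb r' := (strip_u _ hT1u w hwu).trans (hB1 w hwp)
    have hpA : p ∈ K (insert e₂ (Ta r')) ↔ w ∈ Ka r' := hA2
    have hwA : w ∈ K (insert e₂ (Ta r')) ↔ w ∈ Ka r' := hA1 w hwp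
    simp only [hpA, hwA, hpB, hwB]
    by_cases h1 : w ∈ Ka r' <;> by_cases h2 : q ∈ Kb r' <;> by_cases h3 : w ∈ Kb r' <;> simp [h1, h2, h3]
  -- the class ∅: p is red-isolated; on the blue side p joins iff q or w does
  have class_empty : ∀ r' : Finset {j' : {j : ι // j ∉ D} // j' ∉ D'},
      Φ (r'.map emb' ∪ ∅) (r'ᶜ.map emb' ∪ (D' \ ∅)) =
        (if (q ∉ Kb r' ∧ w ∉ Kb r') then ((if w ∈ Ka r' then (1 : ℝ) else 0) - 0) else 0) := by
    intro r'
    simp only [hΦ]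
    rw [hred₀ r', hblue₀ r']
    have hpA : p ∉ K (Ta r') := not_mem_openCluster_of_no_edge ends x (Ta r') hxp (hTa_p r')
    have hT2u : ∀ i ∈ Tb r' ∪ {e₁, e₂}, u ∉ ends i := by
      intro i hi
      rcases Finset.mem_union.mp hi with hi | hi
      · exact hTb_u r' i hi
      · rcases Finset.mem_insert.mp hi with rfl | hi; exact he₁u; rw [Finset.mem_singleton.mp hi]; exact he₂u
    set B' : Set V := K (Tb r' ∪ {e₁, e₂}) with hB'
    have hpB : p ∈ K ((Tb r' ∪ {e₁, e₂}) ∪ (D \ R)) ↔ p ∈ B' := strip_u _ hT2u p hpu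
    have hwB : w ∈ K ((Tb r' ∪ {e₁, e₂}) ∪ (D \ R)) ↔ w ∈ B' := strip_u _ hT2u w hwu
    -- if q or w is blue-reached then so is p
    have hsub : Kb r' ⊆ B' := openCluster_image_mono ends Finset.subset_union_left x
    have he₁m : e₁ ∈ Tb r' ∪ {e₁, e₂} := Finset.mem_union_right _ (by simp)
    have he₂m : e₂ ∈ Tb r' ∪ {e₁, e₂} := Finset.mem_union_right _ (by simp)
    have hq_to_p : q ∈ Kb r' → p ∈ B' := fun h => (mem_openCluster_iff_of_edge ends x _ he₁ hqp he₁m).mpr (hsub h)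
    have hw_to_p : w ∈ Kb r' → p ∈ B' := fun h => (mem_openCluster_iff_of_edge ends x _ he₂ hwp he₂m).mpr (hsub h)
    -- if neither is, the two edges at p are dead: B' ⊆ Kb
    have hclosed : q ∉ Kb r' → w ∉ Kb r' → B' ⊆ Kb r' := by
      intro hq hw
      have hpKb : p ∉ Kb r' := not_mem_openCluster_of_no_edge ends x (Tb r') hxp (hTb_p r')
      refine openCluster_subset_of_adjClosed ends x _ (Kb r') (mem_openCluster_self _ x) ?_
      intro c hc d hcd
      rw [openGraph_image_adj] at hcd
      obtain ⟨⟨i, hi, hicd⟩, hne2⟩ := hcd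
      rcases Finset.mem_union.mp hi with hi | hi
      · have hadj : (openGraph (ends '' (↑(Tb r') : Set ι))).Adj c d := by
          rw [openGraph_image_adj]; exact ⟨⟨i, hi, hicd⟩, hne2⟩
        exact SimpleGraph.Reachable.trans hc hadj.reachable
      · exfalso
        rcases Finset.mem_insert.mp hi with rfl | hi
        · have hcd' : s(c, d) = s(p, q) := by rw [← hicd, he₁]
          rcases Sym2.eq_iff.mp hcd' with ⟨hc1, _⟩ | ⟨hc1, _⟩
          · exact hpKb (hc1 ▸ hc)
          · exact hq (hc1 ▸ hc)
        · rw [Finset.mem_singleton] at hi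
          have hcd' : s(c, d) = s(p, w) := by rw [← hicd, hi, he₂]
          rcases Sym2.eq_iff.mp hcd' with ⟨hc1, _⟩ | ⟨hc1, _⟩
          · exact hpKb (hc1 ▸ hc)
          · exact hw (hc1 ▸ hc)
    simp only [hpA, hpB, hwB, not_false_eq_true, true_and]
    by_cases h1 : q ∈ Kb r'
    · have : p ∈ B' := hq_to_p h1
      simp [h1, this]
    · by_cases h2 : w ∈ Kb r'
      · have : p ∈ B' := hw_to_p h2
        simp [h1, h2, this]
      · have hB'sub := hclosed h1 h2
        have hpB' : p ∉ B' := fun h => (not_mem_openCluster_of_no_edge ends x (Tb r') hxp (hTb_p r')) (hB'sub h)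
        have hwB' : w ∉ B' := fun h => h2 (hB'sub h)
        simp [h1, h2, hpB', hwB', hKa]
  -- assemble the powerset sum: only the classes ∅ and {e₂'} contribute
  have hpow : ∀ R' ∈ D'.powerset,
      ∑ r' : Finset {j' : {j : ι // j ∉ D} // j' ∉ D'}, Φ (r'.map emb' ∪ R') (r'ᶜ.map emb' ∪ (D' \ R')) =
      (if R' = ∅ then ∑ r' : Finset {j' : {j : ι // j ∉ D} // j' ∉ D'}, Φ (r'.map emb' ∪ ∅) (r'ᶜ.map emb' ∪ (D' \ ∅)) else 0) +
      (if R' = {e₂'} then ∑ r' : Finset {j' : {j : ι // j ∉ D} // j' ∉ D'}, Φ (r'.map emb' ∪ {e₂'}) (r'ᶜ.map emb' ∪ (D' \ {e₂'})) else 0) := by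
    intro R' hR'
    have hRD' : R' ⊆ D' := Finset.mem_powerset.mp hR'
    by_cases h1 : e₁' ∈ R'
    · have hne1 : R' ≠ ∅ := fun h => by rw [h] at h1; exact (Finset.notMem_empty _) h1
      have hne2 : R' ≠ {e₂'} := fun h => by rw [h, Finset.mem_singleton] at h1; exact hne' h1
      rw [if_neg hne1, if_neg hne2, class_e₁ R' hR' h1]; ring
    · by_cases h2 : e₂' ∈ R'
      · have hReq : R' = {e₂'} := by
          ext a; constructor
          · intro ha
            rcases Finset.mem_insert.mp (hRD' ha) with rfl | ha'
            · exact absurd ha h1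
            · exact ha'
          · intro ha; rw [Finset.mem_singleton.mp ha]; exact h2
        subst hReq
        have hne1 : ({e₂'} : Finset {j : ι // j ∉ D}) ≠ ∅ := Finset.singleton_ne_empty _
        rw [if_neg hne1, if_pos rfl]; ring
      · have hReq : R' = ∅ := by
          ext a; constructor
          · intro ha
            rcases Finset.mem_insert.mp (hRD' ha) with rfl | ha'
            · exact absurd ha h1
            · rw [Finset.mem_singleton.mp ha'] at ha; exact absurd ha h2
          · intro ha; exact absurd ha (Finset.notMem_empty _)
        subst hReq
        have hne2 : (∅ : Finset {j : ι // j ∉ D}) ≠ {e₂'} := (Finset.singleton_ne_empty _).symm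
        rw [if_pos rfl, if_neg hne2]; ring
  rw [Finset.sum_congr rfl hpow, Finset.sum_add_distrib, Finset.sum_ite_eq' D'.powerset, Finset.sum_ite_eq' D'.powerset,
    if_pos (Finset.empty_mem_powerset D'), if_pos (Finset.mem_powerset.mpr (by
      intro a ha; rw [Finset.mem_singleton.mp ha]; simp [hD']))]
  rw [Finset.sum_congr rfl (fun r' _ => class_empty r'), Finset.sum_congr rfl (fun r' _ => class_e₂ r'), ← Finset.sum_add_distrib]
  -- pointwise: the two classes add up to [q ∉ Kb]·([w ∈ Ka] − [w ∈ Kb])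
  have hpt : ∀ r' : Finset {j' : {j : ι // j ∉ D} // j' ∉ D'},
      (if (q ∉ Kb r' ∧ w ∉ Kb r') then ((if w ∈ Ka r' then (1 : ℝ) else 0) - 0) else 0) +
        (if (w ∉ Ka r' ∧ q ∉ Kb r') then (0 - (if w ∈ Kb r' then (1 : ℝ) else 0)) else 0) =
      (if q ∉ Kb r' then (1 : ℝ) else 0) * ((if w ∈ Ka r' then (1 : ℝ) else 0) - (if w ∈ Kb r' then (1 : ℝ) else 0)) := by
    intro r'
    by_cases h1 : q ∈ Kb r' <;> by_cases h2 : w ∈ Ka r' <;> by_cases h3 : w ∈ Kb r' <;> simp [h1, h2, h3]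
  rw [Finset.sum_congr rfl (fun r' _ => hpt r')]
  -- Harris twice on the reduced sub-cube
  set A₀ : Finset {j' : {j : ι // j ∉ D} // j' ∉ D'} → Set V := fun t => K ((t.map emb').map emb ∪ R) with hA₀
  set A₁ : Finset {j' : {j : ι // j ∉ D} // j' ∉ D'} → Set V := fun t => K ((t.map emb').map emb) with hA₁
  have hmono2 : ∀ {s t : Finset {j' : {j : ι // j ∉ D} // j' ∉ D'}}, s ⊆ t → (s.map emb').map emb ⊆ (t.map emb').map emb :=
    fun hst => Finset.map_subset_map.mpr (Finset.map_subset_map.mpr hst)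
  have hA₀_mono : Monotone A₀ := fun s t hst =>
    openCluster_image_mono ends (Finset.union_subset_union (hmono2 hst) (le_refl R)) x
  have hA₁_mono : Monotone A₁ := fun s t hst => openCluster_image_mono ends (hmono2 hst) x
  have hA₁₀ : ∀ t, A₁ t ⊆ A₀ t := fun t => openCluster_image_mono ends Finset.subset_union_left x
  have hKa : ∀ r', Ka r' = A₀ r' := fun r' => rfl
  have hKb : ∀ r', Kb r' = A₁ r'ᶜ := fun r' => rfl
  simp only [hKa, hKb]
  set E : Finset {j' : {j : ι // j ∉ D} // j' ∉ D'} → ℝ := fun r' => if q ∉ A₁ r'ᶜ then (1 : ℝ) else 0 with hE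
  set G : Finset {j' : {j : ι // j ∉ D} // j' ∉ D'} → ℝ := fun t => if w ∈ A₀ t then (1 : ℝ) else 0 with hG
  have hE_mono : Monotone E := by
    intro s t hst
    simp only [hE]
    by_cases hs : q ∉ A₁ sᶜ
    · have ht : q ∉ A₁ tᶜ := fun h => hs (hA₁_mono (compl_subset_compl.mpr hst) h)
      simp [hs, ht]
    · simp only [hs, if_false]; split_ifs <;> norm_num
  have hG_mono : Monotone G := by
    intro s t hst
    simp only [hG]
    by_cases hs : w ∈ A₀ s
    · simp [hs, hA₀_mono hst hs]
    · simp only [hs, if_false]; split_ifs <;> norm_num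
  have hsplit : ∀ r' : Finset {j' : {j : ι // j ∉ D} // j' ∉ D'},
      E r' * ((if w ∈ A₀ r' then (1 : ℝ) else 0) - (if w ∈ A₁ r'ᶜ then (1 : ℝ) else 0)) =
      E r' * (G r' - G r'ᶜ) + E r' * ((if w ∈ A₀ r'ᶜ then (1 : ℝ) else 0) - (if w ∈ A₁ r'ᶜ then (1 : ℝ) else 0)) := by
    intro r'; simp only [hG]; ring
  change 0 ≤ ∑ r', E r' * ((if w ∈ A₀ r' then (1 : ℝ) else 0) - (if w ∈ A₁ r'ᶜ then (1 : ℝ) else 0))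
  rw [Finset.sum_congr rfl (fun r' _ => hsplit r'), Finset.sum_add_distrib]
  have h1 : 0 ≤ ∑ r', E r' * (G r' - G r'ᶜ) := AntitheticProduct.sum_mul_sub_compl_nonneg E G hE_mono hG_mono
  have h2 : 0 ≤ ∑ r' : Finset {j' : {j : ι // j ∉ D} // j' ∉ D'}, E r' * ((if w ∈ A₀ r'ᶜ then (1 : ℝ) else 0) - (if w ∈ A₁ r'ᶜ then (1 : ℝ) else 0)) := by
    refine Finset.sum_nonneg fun r' _ => mul_nonneg ?_ ?_
    · simp only [hE]; split_ifs <;> norm_num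
    · by_cases h : w ∈ A₁ r'ᶜ
      · have : w ∈ A₀ r'ᶜ := hA₁₀ r'ᶜ h
        simp [h, this]
      · simp only [h, if_false, sub_zero]; split_ifs <;> norm_num
  linarith

end smallWall

end Coefficientwise

end Summit.CriticalPhenomena.PercolationContinuityZ3.Theorems
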